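import Summits.CriticalPhenomena.CardyFormulaZ2.Theorems.CardySelfRefinementLagHandOffKernelContactIdentity
import Literature.Probability.Percolation.AnnulusCrossingBoundProofs
import Literature.Probability.Percolation.OpenPathAnnulusCrossing
import Summits.CriticalPhenomena.CardyFormulaZ2.Theorems.CardyBoundaryCoulombGasRectilinearCardyStubClosureOneArm
import Mathlib.MeasureTheory.Measure.Real
import HarnessLib

/-!
# The corner / strip-end term of the boundary kernel: stub `stub_kernel_cornerNearMiss`
(line `hitting-tournament`, crux `LagHandOff`, stmt-CriticalPhenomena-10268)

Helper for crux stmt-CriticalPhenomena-10268 (`LagHandOff`, line `hitting-tournament`), registered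
stub `stub_kernel_cornerNearMiss` — the CORNER brick of the boundary kernel of seat c6.

Data.  Discrete Dobrushin data `E` (`DiscreteDobrushin`), critical bond percolation `P_{1/2}` on
`ℤ²`, the restricted configuration `ω° = ω ∩ E(Ω_δ)` (`Ω_δ = discreteDomainGraph E.Ω E.δ`), and the
vertex set `Ω_δ ∖ arcs = meshDomain E.Ω E.δ ∖ (E.zdArcA ∪ E.zdArcB)`.  The event bounded here is:
SOME site `c` is joined by `ω°`-open paths inside `Ω_δ ∖ arcs` to a site `y₀` whose mesh point is
within `η` of a point `p` and to a site `y₁` whose mesh point is at distance `≥ L` from `p`.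

Conclusion: with the constants `α, c₀` of the RSW annulus bound
`annulusOpenCrossing_half_le_holds` (`Literature/Probability/Percolation/AnnulusCrossingBound.lean`),
this event has probability `≤ (η / L) ^ α` whenever `0 < δ`, `c₀ δ ≤ η`, `2 η ≤ L`.

Proof.  Composing the two reachabilities through `c` (the induced open graph is symmetric and
transitive) gives an `ω°`-open path inside `Ω_δ ∖ arcs` from `y₁` to `y₀`.  Since
`ω° ⊆ E(Ω_δ) ⊆ E(ℤ²)` (`discreteDomainGraph_le_meshGraph`, `meshGraph_le_zdGraph`), consecutive
vertices of the path are lattice neighbours at mesh distance exactly `δ` (`dist_meshPoint_of_adj`),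
so the chain lemma `mem_annulusOpenCrossing_of_chain` (cut the path at its first vertex at distance
`≥ L` from `p`; all earlier vertices are within `L`, hence all used vertices within `L + 2δ`), in
its landed `openConnIn` form `coa_mem_annulusOpenCrossing_of_openConnIn`
(`Theorems/CardyBoundaryCoulombGasRectilinearCardyStubClosureOneArm.lean`, reused by import), puts
`ω°` in the tree's event `annulusOpenCrossing p δ η L`, and `ω ⊇ ω°` lies in it too (the event is
increasing, `isUpperSet_annulusOpenCrossing`).  Monotonicity of `P_{1/2}.real` (`measureReal_mono`)
and `annulusOpenCrossing_half_le_holds` at `(x, δ, r, R) = (p, E.δ, η, L)` give the bound with the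
SAME `α, c₀`.

References: G. Grimmett, *Percolation*, 2nd ed. (1999), §11.8, proof of Thm (11.89)
[GrimmettPercolation1999]; B. Bollobás, O. Riordan, *Percolation* (2006), Ch. 7 Lemma 4
[BollobasRiordan2006].
-/

noncomputable section

open Set Metric MeasureTheory
open Literature.Probability.Percolation Literature.Probability.LatticeModels
open Literature.Probability.RandomPlanarGeometry

namespace Summit.CriticalPhenomena.CardyFormulaZ2.Cruxes.LagHandOff.HittingTournament

namespace KernelCorner

open Summit.CriticalPhenomena.CardyFormulaZ2.Cruxes.RectilinearCardy.ExcursionKernelCovariance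
  (coa_mem_annulusOpenCrossing_of_openConnIn)

/-- The restricted configuration `ω ∩ E(Ω_δ)` consists of edges of `ℤ²`
(`Ω_δ ≤ meshGraph ≤ ℤ²`). [folklore] -/
theorem inter_edgeSet_subset_edgeSet_zdGraph (E : DiscreteDobrushin) (ω : BondConfig (Site 2)) :
    ω ∩ (discreteDomainGraph E.Ω E.δ).edgeSet ⊆ (zdGraph 2).edgeSet := fun _ he =>
  SimpleGraph.edgeSet_mono
    ((discreteDomainGraph_le_meshGraph E.Ω E.δ).trans (meshGraph_le_zdGraph E.Ω E.δ)) he.2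

/-- **The corner event is a one-arm event.**  If the `ω°`-cluster of `c` inside `Ω_δ ∖ arcs`
(`ω° = ω ∩ E(Ω_δ)`) contains a site `y₀` within `η` of `p` and a site `y₁` at distance `≥ L ≥ η`
from `p` (`δ > 0`), then `ω ∈ annulusOpenCrossing p δ η L`: compose the two reachabilities through
`c` into an `ω°`-open path from `y₁` to `y₀`, apply the landed dictionary lemma
`coa_mem_annulusOpenCrossing_of_openConnIn` (Theorems/…RectilinearCardyStubClosureOneArm: an open
path of `ω° ⊆ E(ℤ²)` from far to near crosses the annulus, by `mem_annulusOpenCrossing_of_chain`),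
and use that the annulus crossing is increasing (`ω° ⊆ ω`). [folklore] -/
theorem cornerEvent_subset_annulusOpenCrossing (E : DiscreteDobrushin) (p : ℂ) {η L : ℝ}
    (hδ : 0 < E.δ) (hηL : η ≤ L) :
    {ω : BondConfig (Site 2) | ∃ c y₀ y₁ : Site 2,
      (ω ∩ (discreteDomainGraph E.Ω E.δ).edgeSet) ∈
          openConnIn (meshDomain E.Ω E.δ \ (E.zdArcA ∪ E.zdArcB)) c y₀ ∧
        (ω ∩ (discreteDomainGraph E.Ω E.δ).edgeSet) ∈
          openConnIn (meshDomain E.Ω E.δ \ (E.zdArcA ∪ E.zdArcB)) c y₁ ∧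
        dist (meshPoint E.δ y₀) p ≤ η ∧ L ≤ dist (meshPoint E.δ y₁) p} ⊆
      annulusOpenCrossing p E.δ η L := by
  rintro ω ⟨c, y₀, y₁, ⟨_, hy₀S, h₀⟩, ⟨_, hy₁S, h₁⟩, hy₀, hy₁⟩
  have h10 : (ω ∩ (discreteDomainGraph E.Ω E.δ).edgeSet) ∈
      openConnIn (meshDomain E.Ω E.δ \ (E.zdArcA ∪ E.zdArcB)) y₁ y₀ :=
    ⟨hy₁S, hy₀S, h₁.symm.trans h₀⟩
  exact isUpperSet_annulusOpenCrossing p E.δ η L inter_subset_left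
    (coa_mem_annulusOpenCrossing_of_openConnIn hδ (inter_edgeSet_subset_edgeSet_zdGraph E ω) h10
      hy₀ hηL hy₁)

end KernelCorner

open KernelCorner in
/-- **Stub `stub_kernel_cornerNearMiss` (corner / strip-end term of the boundary kernel).**
With the constants `α, c₀ > 0` of the RSW annulus bound `annulusOpenCrossing_half_le_holds`
(Grimmett 1999, §11.8; Bollobás–Riordan 2006, Ch. 7 Lemma 4, bond-`ℤ²` form): for all discrete
Dobrushin data `E`, points `p` and radii with `0 < δ`, `c₀ δ ≤ η`, `2 η ≤ L`, the probability under
`P_{1/2}` that some `ω ∩ E(Ω_δ)`-cluster inside `Ω_δ ∖ arcs` contains a site within `η` of `p` and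
a site at distance `≥ L` from `p` is at most `(η / L) ^ α` — the event is contained in the open
crossing of the annulus `A(p; η, L)` (`cornerEvent_subset_annulusOpenCrossing`), whose probability
the RSW bound controls. [folklore] -/
theorem stub_kernel_cornerNearMiss : ∃ α c₀ : ℝ, 0 < α ∧ 0 < c₀ ∧ ∀ (E : DiscreteDobrushin) (p : ℂ) (η L : ℝ), 0 < E.δ → c₀ * E.δ ≤ η → 2 * η ≤ L → (bondPercolation (zdGraph 2) half).real {ω | ∃ c y₀ y₁ : Site 2, (ω ∩ (discreteDomainGraph E.Ω E.δ).edgeSet) ∈ openConnIn (meshDomain E.Ω E.δ \ (E.zdArcA ∪ E.zdArcB)) c y₀ ∧ (ω ∩ (discreteDomainGraph E.Ω E.δ).edgeSet) ∈ openConnIn (meshDomain E.Ω E.δ \ (E.zdArcA ∪ E.zdArcB)) c y₁ ∧ dist (meshPoint E.δ y₀) p ≤ η ∧ L ≤ dist (meshPoint E.δ y₁) p} ≤ (η / L) ^ α := by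
  obtain ⟨α, c₀, hα, hc₀, hbound⟩ := annulusOpenCrossing_half_le_holds
  refine ⟨α, c₀, hα, hc₀, fun E p η L hδ hη hL => le_trans ?_ (hbound p E.δ η L hδ hη hL)⟩
  have hη0 : 0 ≤ η := le_trans (mul_pos hc₀ hδ).le hη
  exact measureReal_mono (cornerEvent_subset_annulusOpenCrossing E p hδ (by linarith))
    (measure_ne_top _ _)

end Summit.CriticalPhenomena.CardyFormulaZ2.Cruxes.LagHandOff.HittingTournament
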